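import Summits.AtomisticToContinuum.HydrodynamicLimit.Theses.CollisionIsometryCLT

/-!
# Kinetic engine glue (route `CollisionIsometryCLT`, item stmt-AtomisticToContinuum-14871)

Pure-logic bookkeeping: the two engine cruxes `DiffuseBackwardInfluence` and `AdaptedWeightCLT`,
fed for each `0 < t < T` in the dilute chamber with component (i) of `AprioriBoundsPreShock`,
yield the pre-shock target `FastMomentRelaxationPreShock`.
At fixed profiles take `σ₀ := min σ₁ (min σ₂ σ₃)` and `η₁ :=` the `η₁` of `AprioriBoundsPreShock`;
at `(σ, Φ)` the first hypothesis of `AdaptedWeightCLT` is the conclusion of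
`DiffuseBackwardInfluence` verbatim, and under the kernel binders its per-`t` hypothesis is
`(AprioriBoundsPreShock … T ρ θ u sol Φ lln t ht htT hdil).1` — literally the inline block of the
route's deciding theorem `closes`.

History: up to route rev 11 this module proved the same decl name for item
stmt-AtomisticToContinuum-14177 (`DiffuseBackwardInfluence → AdaptedWeightCLT → AprioriBounds →
FastMomentRelaxation`, commit 98a28b57767c); route revs 12–13 re-typed `KineticEngineGlue` onto the
pre-shock, dilute-chamber items `AprioriBoundsPreShock` (stmt-AtomisticToContinuum-14827) and
`FastMomentRelaxationPreShock` (stmt-AtomisticToContinuum-14902), and the proof below is the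
re-proof of the unchanged statement `KineticEngineGlue` against them.
-/

namespace Summit.AtomisticToContinuum.HydrodynamicLimit.Theorems

open Summit.AtomisticToContinuum.HydrodynamicLimit.Theses.CollisionIsometryCLT

/-- The kinetic engine glue `DiffuseBackwardInfluence → AdaptedWeightCLT → AprioriBoundsPreShock →
FastMomentRelaxationPreShock` (item stmt-AtomisticToContinuum-14871, route revs 12–13): with
`σ₀ := min σ₁ (min σ₂ σ₃)` and the `η₁` of `AprioriBoundsPreShock`, feed `AdaptedWeightCLT` at
`(σ, Φ)` the conclusion of `DiffuseBackwardInfluence` at `(σ, Φ)` and, for `0 < t < T` with the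
hs-Euler solution dilute on `[0, t]`, the first component of `AprioriBoundsPreShock` at `t`. -/
theorem kineticEngineGlue_proof :
    Summit.AtomisticToContinuum.HydrodynamicLimit.Theses.CollisionIsometryCLT.KineticEngineGlue := by
  unfold KineticEngineGlue
  intro hD hC h₃ a₀ θ₀ u₀ ha hθ hu hapos hθpos
  obtain ⟨σ₁, hσ₁, H1⟩ := hD a₀ θ₀ u₀ ha hθ hu hapos hθpos
  obtain ⟨σ₂, hσ₂, H2⟩ := hC a₀ θ₀ u₀ ha hθ hu hapos hθpos
  obtain ⟨σ₃, hσ₃, η₁, hη₁, H3⟩ := h₃ a₀ θ₀ u₀ ha hθ hu hapos hθpos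
  refine ⟨min σ₁ (min σ₂ σ₃), lt_min hσ₁ (lt_min hσ₂ hσ₃), η₁, hη₁, ?_⟩
  intro σ hσ hσlt T ρ θ u hsol Φ hLLN
  have h1 := H1 σ hσ (lt_of_lt_of_le hσlt (min_le_left _ _))
  have h2 := H2 σ hσ (lt_of_lt_of_le hσlt ((min_le_right _ _).trans (min_le_left _ _)))
  have h3 := H3 σ hσ (lt_of_lt_of_le hσlt ((min_le_right _ _).trans (min_le_right _ _)))
    T ρ θ u hsol Φ hLLN
  intro γ C φ hγ hγ' hadm ρb mb ub D q t ht htT hdil δ hδ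
  exact h2 Φ (h1 Φ) γ C φ hγ hγ' hadm t ht (h3 t ht htT hdil).1 δ hδ

end Summit.AtomisticToContinuum.HydrodynamicLimit.Theorems
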